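import Literature.MathematicalPhysics.QuantumFieldTheory.Balaban1983to89.B8LeafModelZdPer
import Literature.MathematicalPhysics.QuantumFieldTheory.Balaban1983to89.B8LeafModelZd3P2

/-!
# `Balaban1983to89.B8LeafModelZdHP2Per` — [Balaban1985RegularSpaces] THE `P`-PERIODIC SUB-MODEL OF THE REPAIRED MEMBER OF RECORD `zdGF3HP₂`
# (the carrier of the «P₂D» road: `Node00.CarriersB8SubBP2D.famB8OfRecordSubBP₂D θ β len j := zdGF3HP₂ θ.𝔸 θ.L β len j.1.1.1.1`) AS A
# `B8SectGH.GFData3` — the member model the periodic re-key of the P-chain actually reads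

statement-level skeleton of published theorems with citation tags; proofs where landed; nothing here is a claim about the
Yang–Mills mass gap

PDF held: `paper:balaban1985-cmp99-regular-spaces-gauge-fixing` (journal page = PDF page + 74); pp. 77, 82–83, 87–88, 100–101.

## WHY THIS FILE (cell `pub-ymgap`, HUMAN RULING D-0062; director-ym №217 (1) (Q2) «(β′-PERIODIC) behind the ∅ [B8] display»; plan g86 PENS-217 P1∕P4;
dag-n05-c g16 LOCATED-MODEL (pub-ymgap bus 2026-08-28): the P₂D road of record runs on `zdGF3HP₂`, not on `zdGF3`; count-neutral)

`B8LeafModelZdPer.zdGF3Per` (P1) is the periodic sub-model of n05-a's ORIGINAL member `zdGF3`.  The road of record since the shell-mode ∕ class findings is the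
REPAIRED member `B8LeafModelZd3P2.zdGF3HP₂ = { zdGF3P₂ with InR := zdGF3H.InR }` — `zdGF3` with (1.35)∕(1.66) read on the one-end-point class `EndBlockIn`,
(1.37)∕(1.42) on print's class `towerBondsP L Ω (Λs k) j`, (1.36) with the δ₂ Hölder class (both end-points in `Ω_j`), and Theorem 8's source premiss `InR`
honest (`InR138 ∧` Hermitian `∧` support `∧ Bdd`).  Its carrier TYPES are `zdGF3`'s (`zdGF3P₂_Cfg ∕ _Pert ∕ _GT ∕ _Src`, `rfl`), so THIS FILE is P1's wrapper
with the bodies delegated to `zdGF3HP₂`: `zdGF3HP₂Per 𝔸 L β len i P` — periodic unitary configurations ∕ pairs ∕ gauge transformations ∕ sources (P1's very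
subtypes, `T4TermwiseTorus.IsPeriodic P`), every predicate ∕ norm = `zdGF3HP₂`'s on `.1`, `act` closed by P1's `isPeriodic_mgauge`.  The periodic P₂D pin
(dag-n05-w1, `Node00/CarriersB8SubBP2DPer`) reads `famB8OfRecordSubBP₂DPer θ β len P j := zdGF3HP₂Per θ.𝔸 θ.L β len j.toZdIdx P`.

## WHAT IS PROVED (kernel, 0 sorry)

§1 `zdGF3HP₂Per`; §2 the carriers ARE P1's (`rfl`) and the projections `cfgZdH ∕ pertZdH ∕ gtZdH ∕ srcZdH` onto `zdGF3HP₂`'s carriers; §3 FIELD TRANSFER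
(`Iff.rfl` ∕ `rfl`) for every field incl. the four re-read ones (`avgClose_iff`, `avgClose166_iff`, `c137_iff`, `c136_iff`, `inR_iff`) + `pertZdH_act`;
§4 non-vacuity (`nonempty_cfg ∕ _pert ∕ _gt ∕ _src`); §5 the free ∀-transfer of Proposition 3 along any index ∕ period maps (`prop3Body_hp2per_of_zd`,
`prop3Printed_hp2per_of_zd`).

## HONEST SCOPE

A DEFINITION file with bookkeeping lemmas; nothing of [Balaban1985RegularSpaces]'s estimates proved; the ∃!-conjuncts' transfer («uniqueness ⇒ periodicity»)
for this member is the sibling `B8LeafModelZdHP2PerTransfer`.  Count-neutral; N05 NOT discharged; one finite `T⁴` programme at fixed `ε`; nothing continuum ∕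
ℝ⁴ ∕ OS ∕ mass-gap ∕ Clay.  Unit `pub-ymgap-dag-n05-c` (g16), 2026-08-28.  No `sorry`, no `axiom`, no `instance`, no `notation`.
-/

noncomputable section

open NormedSpace

namespace Literature.MathematicalPhysics.QuantumFieldTheory.Balaban1983to89.B8LeafModelZdHP2Per

open B7Prop1Explicit B7Prop2Explicit B7Eq92Concrete
open B8LeafModelZd (ZdIdx)
open B8LeafModelZd3 (zdGF3)
open B8LeafModelZd3P2 (zdGF3HP₂)
open B8LeafModelZdPer (zdGF3Per isPeriodic_const)
open B8Prop3GaugeFixedKLevel (mem_unitaryUnits_of_mgauge_eq)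
open B8Thm4AtLandau138 (mgauge_mgauge_inv)
open T4TermwiseTorus (IsPeriodic)

-- `Site` alone could resolve to the torus sites of `Setup.lean`; re-export the `ℤ^d` sites of `B7Prop1Explicit`.
export B7Prop1Explicit (Site)

variable {d : ℕ}

/-! ## §1 The member: `zdGF3HP₂` read on `P`-periodic data -/

section Family

variable (𝔸 : Type) [CStarAlgebra 𝔸] (L : ℕ) (β : ℝ) (len : Site d → ℝ)

/-- **The `P`-periodic sub-model of the REPAIRED member of record `zdGF3HP₂`** (the «P₂D» road's carrier) as `B8SectGH.GFData3`: carriers = the `P`-periodic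
unitary configurations ∕ pairs ∕ gauge transformations ∕ sources of `B8LeafModelZdPer.zdGF3Per` (same subtypes), every predicate ∕ norm = `zdGF3HP₂`'s body
at the underlying `ℤᵈ` fields (print's theorems live on the finite torus `T_η`, p. 77).
[cite: Balaban1985RegularSpaces, p.77 («Ω₀ ⊃ Ω₁ ⊃ … ⊃ Ω_k … we admit the case when some domains Ω_j are equal to T_η»), (1.29) p.81, (1.33)–(1.39) pp.82–83, (1.40) p.83, (1.62) p.87, (1.66) p.88, (1.140) p.100, (1.146) p.101] -/
def zdGF3HP₂Per (i : ZdIdx d L) (P : ℕ) : B8SectGH.GFData3 where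
  Cfg := (zdGF3Per 𝔸 L β len i P).Cfg
  Pert := (zdGF3Per 𝔸 L β len i P).Pert
  GT := (zdGF3Per 𝔸 L β len i P).GT
  Src := (zdGF3Per 𝔸 L β len i P).Src
  k := i.k
  InA := fun α U₀ => (zdGF3HP₂ 𝔸 L β len i).InA α ⟨U₀.1, U₀.2.1⟩
  Reg335 := fun α U₀ => (zdGF3HP₂ 𝔸 L β len i).Reg335 α ⟨U₀.1, U₀.2.1⟩
  InAAx := fun α U₀ Q => (zdGF3HP₂ 𝔸 L β len i).InAAx α ⟨U₀.1, U₀.2.1⟩ (⟨Q.1.1, Q.1.2.1⟩, ⟨Q.2.1, Q.2.2.1⟩)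
  avgClose := fun α U₀ Q => (zdGF3HP₂ 𝔸 L β len i).avgClose α ⟨U₀.1, U₀.2.1⟩ (⟨Q.1.1, Q.1.2.1⟩, ⟨Q.2.1, Q.2.2.1⟩)
  avgClose166 := fun α U₀ Q => (zdGF3HP₂ 𝔸 L β len i).avgClose166 α ⟨U₀.1, U₀.2.1⟩ (⟨Q.1.1, Q.1.2.1⟩, ⟨Q.2.1, Q.2.2.1⟩)
  Restricted := fun U₀ u => (zdGF3HP₂ 𝔸 L β len i).Restricted ⟨U₀.1, U₀.2.1⟩ ⟨u.1, u.2.1⟩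
  act := (zdGF3Per 𝔸 L β len i P).act
  C136 := fun B₁ B₂ s U₀ Q => (zdGF3HP₂ 𝔸 L β len i).C136 B₁ B₂ s ⟨U₀.1, U₀.2.1⟩ (⟨Q.1.1, Q.1.2.1⟩, ⟨Q.2.1, Q.2.2.1⟩)
  C137 := fun α₁ U₀ Q => (zdGF3HP₂ 𝔸 L β len i).C137 α₁ ⟨U₀.1, U₀.2.1⟩ (⟨Q.1.1, Q.1.2.1⟩, ⟨Q.2.1, Q.2.2.1⟩)
  Landau := fun U₀ Q => (zdGF3HP₂ 𝔸 L β len i).Landau ⟨U₀.1, U₀.2.1⟩ (⟨Q.1.1, Q.1.2.1⟩, ⟨Q.2.1, Q.2.2.1⟩)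
  C139 := fun B s U₀ Q => (zdGF3HP₂ 𝔸 L β len i).C139 B s ⟨U₀.1, U₀.2.1⟩ (⟨Q.1.1, Q.1.2.1⟩, ⟨Q.2.1, Q.2.2.1⟩)
  C162 := fun B s U₀ Q => (zdGF3HP₂ 𝔸 L β len i).C162 B s ⟨U₀.1, U₀.2.1⟩ (⟨Q.1.1, Q.1.2.1⟩, ⟨Q.2.1, Q.2.2.1⟩)
  fNorm := fun f => (zdGF3HP₂ 𝔸 L β len i).fNorm f.1
  LandauF := fun U₀ f Q => (zdGF3HP₂ 𝔸 L β len i).LandauF ⟨U₀.1, U₀.2.1⟩ f.1 (⟨Q.1.1, Q.1.2.1⟩, ⟨Q.2.1, Q.2.2.1⟩)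
  InAPair := fun α U₀ Q => (zdGF3HP₂ 𝔸 L β len i).InAPair α ⟨U₀.1, U₀.2.1⟩ (⟨Q.1.1, Q.1.2.1⟩, ⟨Q.2.1, Q.2.2.1⟩)
  fGrad := fun U₀ f => (zdGF3HP₂ 𝔸 L β len i).fGrad ⟨U₀.1, U₀.2.1⟩ f.1
  C140 := fun α₂ U₀ Q => (zdGF3HP₂ 𝔸 L β len i).C140 α₂ ⟨U₀.1, U₀.2.1⟩ (⟨Q.1.1, Q.1.2.1⟩, ⟨Q.2.1, Q.2.2.1⟩)
  InR := fun U₀ f => (zdGF3HP₂ 𝔸 L β len i).InR ⟨U₀.1, U₀.2.1⟩ f.1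

end Family

/-! ## §2 Carriers and projections -/

section Projections

variable {𝔸 : Type} [CStarAlgebra 𝔸] {L : ℕ} {β : ℝ} {len : Site d → ℝ} {i : ZdIdx d L} {P : ℕ}

/-- The carriers ARE P1's periodic carriers (`rfl`). [cite: Balaban1985RegularSpaces, p.77 (bookkeeping)] -/
theorem cfg_eq : (zdGF3HP₂Per 𝔸 L β len i P).Cfg = (zdGF3Per 𝔸 L β len i P).Cfg := rfl

/-- [cite: Balaban1985RegularSpaces, p.77 (bookkeeping)] -/
theorem pert_eq : (zdGF3HP₂Per 𝔸 L β len i P).Pert = (zdGF3Per 𝔸 L β len i P).Pert := rfl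

/-- [cite: Balaban1985RegularSpaces, p.77 (bookkeeping)] -/
theorem gt_eq : (zdGF3HP₂Per 𝔸 L β len i P).GT = (zdGF3Per 𝔸 L β len i P).GT := rfl

/-- [cite: Balaban1985RegularSpaces, p.77 (bookkeeping)] -/
theorem src_eq : (zdGF3HP₂Per 𝔸 L β len i P).Src = (zdGF3Per 𝔸 L β len i P).Src := rfl

/-- The gauge action IS P1's (`rfl`). [cite: Balaban1985Averaging, (55) p.27; Balaban1985RegularSpaces, p.83] -/
theorem act_eq : (zdGF3HP₂Per 𝔸 L β len i P).act = (zdGF3Per 𝔸 L β len i P).act := rfl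

/-- The underlying configuration of `zdGF3HP₂` (forget periodicity). [cite: Balaban1985RegularSpaces, p.77 («Ω₀ = T_η»)] -/
def cfgZdH (U : (zdGF3HP₂Per 𝔸 L β len i P).Cfg) : (zdGF3HP₂ 𝔸 L β len i).Cfg := ⟨U.1, U.2.1⟩

/-- The underlying perturbation pair of `zdGF3HP₂`. [cite: Balaban1985RegularSpaces, p.77, (1.34) p.82] -/
def pertZdH (Q : (zdGF3HP₂Per 𝔸 L β len i P).Pert) : (zdGF3HP₂ 𝔸 L β len i).Pert := (⟨Q.1.1, Q.1.2.1⟩, ⟨Q.2.1, Q.2.2.1⟩)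

/-- The underlying gauge transformation of `zdGF3HP₂`. [cite: Balaban1985RegularSpaces, p.77, (1.29) p.81] -/
def gtZdH (u : (zdGF3HP₂Per 𝔸 L β len i P).GT) : (zdGF3HP₂ 𝔸 L β len i).GT := ⟨u.1, u.2.1⟩

/-- The underlying source of `zdGF3HP₂`. [cite: Balaban1985RegularSpaces, p.77, (1.146) p.101] -/
def srcZdH (f : (zdGF3HP₂Per 𝔸 L β len i P).Src) : (zdGF3HP₂ 𝔸 L β len i).Src := f.1

/-- [cite: Balaban1985RegularSpaces, p.77 (bookkeeping)] -/
@[simp] theorem cfgZdH_val (U : (zdGF3HP₂Per 𝔸 L β len i P).Cfg) : (cfgZdH U).1 = U.1 := rfl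
/-- [cite: Balaban1985RegularSpaces, p.77 (bookkeeping)] -/
@[simp] theorem pertZdH_fst_val (Q : (zdGF3HP₂Per 𝔸 L β len i P).Pert) : (pertZdH Q).1.1 = Q.1.1 := rfl
/-- [cite: Balaban1985RegularSpaces, p.77 (bookkeeping)] -/
@[simp] theorem pertZdH_snd_val (Q : (zdGF3HP₂Per 𝔸 L β len i P).Pert) : (pertZdH Q).2.1 = Q.2.1 := rfl
/-- [cite: Balaban1985RegularSpaces, p.77 (bookkeeping)] -/
@[simp] theorem gtZdH_val (u : (zdGF3HP₂Per 𝔸 L β len i P).GT) : (gtZdH u).1 = u.1 := rfl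
/-- [cite: Balaban1985RegularSpaces, p.77 (bookkeeping)] -/
@[simp] theorem srcZdH_eq (f : (zdGF3HP₂Per 𝔸 L β len i P).Src) : srcZdH f = f.1 := rfl

/-- The number of levels is the geometry's `k`. [cite: Balaban1985RegularSpaces, (1.3) p.77] -/
theorem k_eq : (zdGF3HP₂Per 𝔸 L β len i P).k = i.k := rfl

end Projections

/-! ## §3 Field transfer: every predicate ∕ norm of `zdGF3HP₂Per` IS `zdGF3HP₂`'s at the projected arguments -/

section Transfer

variable {𝔸 : Type} [CStarAlgebra 𝔸] {L : ℕ} {β : ℝ} {len : Site d → ℝ} {i : ZdIdx d L} {P : ℕ}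

/-- (1.33). [cite: Balaban1985RegularSpaces, (1.33) p.82] -/
theorem inA_iff (α : ℝ) (U₀ : (zdGF3HP₂Per 𝔸 L β len i P).Cfg) :
    (zdGF3HP₂Per 𝔸 L β len i P).InA α U₀ ↔ (zdGF3HP₂ 𝔸 L β len i).InA α (cfgZdH U₀) := Iff.rfl

/-- «(3.35) of [4]» (`True`). [cite: Balaban1985RegularSpaces, p.83 («eventually we will drop it»)] -/
theorem reg335_iff (α : ℝ) (U₀ : (zdGF3HP₂Per 𝔸 L β len i P).Cfg) :
    (zdGF3HP₂Per 𝔸 L β len i P).Reg335 α U₀ ↔ (zdGF3HP₂ 𝔸 L β len i).Reg335 α (cfgZdH U₀) := Iff.rfl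

/-- (1.34). [cite: Balaban1985RegularSpaces, (1.34) p.82] -/
theorem inAAx_iff (α : ℝ) (U₀ : (zdGF3HP₂Per 𝔸 L β len i P).Cfg) (Q : (zdGF3HP₂Per 𝔸 L β len i P).Pert) :
    (zdGF3HP₂Per 𝔸 L β len i P).InAAx α U₀ Q ↔ (zdGF3HP₂ 𝔸 L β len i).InAAx α (cfgZdH U₀) (pertZdH Q) := Iff.rfl

/-- (1.35) on the one-end-point class `EndBlockIn` (the repaired letter). [cite: Balaban1985RegularSpaces, (1.35) p.82, p.77] -/
theorem avgClose_iff (α : ℝ) (U₀ : (zdGF3HP₂Per 𝔸 L β len i P).Cfg) (Q : (zdGF3HP₂Per 𝔸 L β len i P).Pert) :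
    (zdGF3HP₂Per 𝔸 L β len i P).avgClose α U₀ Q ↔ (zdGF3HP₂ 𝔸 L β len i).avgClose α (cfgZdH U₀) (pertZdH Q) := Iff.rfl

/-- (1.66) (repaired letter). [cite: Balaban1985RegularSpaces, (1.66) p.88] -/
theorem avgClose166_iff (α : ℝ) (U₀ : (zdGF3HP₂Per 𝔸 L β len i P).Cfg) (Q : (zdGF3HP₂Per 𝔸 L β len i P).Pert) :
    (zdGF3HP₂Per 𝔸 L β len i P).avgClose166 α U₀ Q ↔ (zdGF3HP₂ 𝔸 L β len i).avgClose166 α (cfgZdH U₀) (pertZdH Q) := Iff.rfl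

/-- (1.29). [cite: Balaban1985RegularSpaces, (1.29) p.81] -/
theorem restricted_iff (U₀ : (zdGF3HP₂Per 𝔸 L β len i P).Cfg) (u : (zdGF3HP₂Per 𝔸 L β len i P).GT) :
    (zdGF3HP₂Per 𝔸 L β len i P).Restricted U₀ u ↔ (zdGF3HP₂ 𝔸 L β len i).Restricted (cfgZdH U₀) (gtZdH u) := Iff.rfl

/-- The gauge action commutes with forgetting periodicity. [cite: Balaban1985Averaging, (55) p.27; Balaban1985RegularSpaces, p.83] -/
theorem pertZdH_act (Q : (zdGF3HP₂Per 𝔸 L β len i P).Pert) (u : (zdGF3HP₂Per 𝔸 L β len i P).GT) :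
    pertZdH ((zdGF3HP₂Per 𝔸 L β len i P).act Q u) = (zdGF3HP₂ 𝔸 L β len i).act (pertZdH Q) (gtZdH u) := rfl

/-- (1.36), δ₂ edition. [cite: Balaban1985RegularSpaces, (1.36) p.82; Balaban1985BackgroundPropagators, (3.40) p.397] -/
theorem c136_iff (B₁ B₂ s : ℝ) (U₀ : (zdGF3HP₂Per 𝔸 L β len i P).Cfg) (Q : (zdGF3HP₂Per 𝔸 L β len i P).Pert) :
    (zdGF3HP₂Per 𝔸 L β len i P).C136 B₁ B₂ s U₀ Q ↔ (zdGF3HP₂ 𝔸 L β len i).C136 B₁ B₂ s (cfgZdH U₀) (pertZdH Q) := Iff.rfl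

/-- (1.37) ∕ (1.42) on print's class `towerBondsP`. [cite: Balaban1985RegularSpaces, (1.37) p.82, (1.42) p.83, (1.31) p.82] -/
theorem c137_iff (α₁ : ℝ) (U₀ : (zdGF3HP₂Per 𝔸 L β len i P).Cfg) (Q : (zdGF3HP₂Per 𝔸 L β len i P).Pert) :
    (zdGF3HP₂Per 𝔸 L β len i P).C137 α₁ U₀ Q ↔ (zdGF3HP₂ 𝔸 L β len i).C137 α₁ (cfgZdH U₀) (pertZdH Q) := Iff.rfl

/-- (1.38). [cite: Balaban1985RegularSpaces, (1.38) p.82] -/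
theorem landau_iff (U₀ : (zdGF3HP₂Per 𝔸 L β len i P).Cfg) (Q : (zdGF3HP₂Per 𝔸 L β len i P).Pert) :
    (zdGF3HP₂Per 𝔸 L β len i P).Landau U₀ Q ↔ (zdGF3HP₂ 𝔸 L β len i).Landau (cfgZdH U₀) (pertZdH Q) := Iff.rfl

/-- (1.39). [cite: Balaban1985RegularSpaces, (1.39) p.83] -/
theorem c139_iff (B s : ℝ) (U₀ : (zdGF3HP₂Per 𝔸 L β len i P).Cfg) (Q : (zdGF3HP₂Per 𝔸 L β len i P).Pert) :
    (zdGF3HP₂Per 𝔸 L β len i P).C139 B s U₀ Q ↔ (zdGF3HP₂ 𝔸 L β len i).C139 B s (cfgZdH U₀) (pertZdH Q) := Iff.rfl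

/-- (1.62). [cite: Balaban1985RegularSpaces, (1.62) p.87] -/
theorem c162_iff (B s : ℝ) (U₀ : (zdGF3HP₂Per 𝔸 L β len i P).Cfg) (Q : (zdGF3HP₂Per 𝔸 L β len i P).Pert) :
    (zdGF3HP₂Per 𝔸 L β len i P).C162 B s U₀ Q ↔ (zdGF3HP₂ 𝔸 L β len i).C162 B s (cfgZdH U₀) (pertZdH Q) := Iff.rfl

/-- `|f|₍₋₂₎`. [cite: Balaban1985RegularSpaces, Thm 8 p.101] -/
theorem fNorm_eq (f : (zdGF3HP₂Per 𝔸 L β len i P).Src) :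
    (zdGF3HP₂Per 𝔸 L β len i P).fNorm f = (zdGF3HP₂ 𝔸 L β len i).fNorm (srcZdH f) := rfl

/-- (1.146). [cite: Balaban1985RegularSpaces, (1.146) p.101] -/
theorem landauF_iff (U₀ : (zdGF3HP₂Per 𝔸 L β len i P).Cfg) (f : (zdGF3HP₂Per 𝔸 L β len i P).Src) (Q : (zdGF3HP₂Per 𝔸 L β len i P).Pert) :
    (zdGF3HP₂Per 𝔸 L β len i P).LandauF U₀ f Q ↔ (zdGF3HP₂ 𝔸 L β len i).LandauF (cfgZdH U₀) (srcZdH f) (pertZdH Q) := Iff.rfl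

/-- (1.40)₂. [cite: Balaban1985RegularSpaces, (1.40) p.83] -/
theorem inAPair_iff (α : ℝ) (U₀ : (zdGF3HP₂Per 𝔸 L β len i P).Cfg) (Q : (zdGF3HP₂Per 𝔸 L β len i P).Pert) :
    (zdGF3HP₂Per 𝔸 L β len i P).InAPair α U₀ Q ↔ (zdGF3HP₂ 𝔸 L β len i).InAPair α (cfgZdH U₀) (pertZdH Q) := Iff.rfl

/-- `|D^η_{U₀} f|₍₋₃₎`. [cite: Balaban1985RegularSpaces, Thm 8 p.101] -/
theorem fGrad_eq (U₀ : (zdGF3HP₂Per 𝔸 L β len i P).Cfg) (f : (zdGF3HP₂Per 𝔸 L β len i P).Src) :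
    (zdGF3HP₂Per 𝔸 L β len i P).fGrad U₀ f = (zdGF3HP₂ 𝔸 L β len i).fGrad (cfgZdH U₀) (srcZdH f) := rfl

/-- (1.140). [cite: Balaban1985RegularSpaces, (1.140) p.100] -/
theorem c140_iff (α₂ : ℝ) (U₀ : (zdGF3HP₂Per 𝔸 L β len i P).Cfg) (Q : (zdGF3HP₂Per 𝔸 L β len i P).Pert) :
    (zdGF3HP₂Per 𝔸 L β len i P).C140 α₂ U₀ Q ↔ (zdGF3HP₂ 𝔸 L β len i).C140 α₂ (cfgZdH U₀) (pertZdH Q) := Iff.rfl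

/-- «f from the space R(U₀)», honest reading (`InR138 ∧` Hermitian `∧` support `∧ Bdd`). [cite: Balaban1985RegularSpaces, Thm 8 p.101, (1.38) p.82] -/
theorem inR_iff (U₀ : (zdGF3HP₂Per 𝔸 L β len i P).Cfg) (f : (zdGF3HP₂Per 𝔸 L β len i P).Src) :
    (zdGF3HP₂Per 𝔸 L β len i P).InR U₀ f ↔ (zdGF3HP₂ 𝔸 L β len i).InR (cfgZdH U₀) (srcZdH f) := Iff.rfl

end Transfer

/-! ## §4 Non-vacuity -/

section Closure

variable {𝔸 : Type} [CStarAlgebra 𝔸] {L : ℕ} {β : ℝ} {len : Site d → ℝ} (i : ZdIdx d L) (P : ℕ)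

/-- [cite: Balaban1985RegularSpaces, (1.33) p.82] -/
theorem nonempty_cfg : Nonempty (zdGF3HP₂Per 𝔸 L β len i P).Cfg := B8LeafModelZdPer.nonempty_cfg (𝔸 := 𝔸) (β := β) (len := len) (i := i) (P := P)
/-- [cite: Balaban1985RegularSpaces, (1.34) p.82] -/
theorem nonempty_pert : Nonempty (zdGF3HP₂Per 𝔸 L β len i P).Pert := B8LeafModelZdPer.nonempty_pert (𝔸 := 𝔸) (β := β) (len := len) (i := i) (P := P)
/-- [cite: Balaban1985RegularSpaces, (1.29) p.81] -/
theorem nonempty_gt : Nonempty (zdGF3HP₂Per 𝔸 L β len i P).GT := B8LeafModelZdPer.nonempty_gt (𝔸 := 𝔸) (β := β) (len := len) (i := i) (P := P)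
/-- [cite: Balaban1985RegularSpaces, Thm 8 p.101] -/
theorem nonempty_src : Nonempty (zdGF3HP₂Per 𝔸 L β len i P).Src := B8LeafModelZdPer.nonempty_src (𝔸 := 𝔸) (β := β) (len := len) (i := i) (P := P)

end Closure

/-! ## §5 The free ∀-transfer: Proposition 3 passes from the `zdGF3HP₂` family to the periodic family -/

section Prop3

variable {𝔸 : Type} [CStarAlgebra 𝔸] {L : ℕ} {β : ℝ} {len : Site d → ℝ}

/-- **PROPOSITION 3's BODY TRANSFERS TO PERIODIC DATA** (pure-∀ sentence; §3). [cite: Balaban1985RegularSpaces, Prop. 3 p.87] -/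
theorem prop3Body_hp2per_of_zd {J : Type} (ι : J → ZdIdx d L) (p : J → ℕ) {c : ℝ} {Lr C₂ : ℝ} {inp : B8.B9Inputs} {B₀β : ℝ}
    (h : B8.Prop3Body c d Lr C₂ inp B₀β (fun j : J => (zdGF3HP₂ 𝔸 L β len (ι j)).toGFData2)) :
    B8.Prop3Body c d Lr C₂ inp B₀β (fun j : J => (zdGF3HP₂Per 𝔸 L β len (ι j) (p j)).toGFData2) := by
  intro j α₀ α₁ α₂ hα₀ hα₀c hα₁ hα₁c hα₂ hα₂c hwin U₀ U₁ hInA hReg hPair h162 hLan h137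
  exact h j α₀ α₁ α₂ hα₀ hα₀c hα₁ hα₁c hα₂ hα₂c hwin (cfgZdH U₀) (pertZdH U₁) hInA hReg hPair h162 hLan h137

/-- **PROPOSITION 3 TRANSFERS TO PERIODIC DATA** (same threshold). [cite: Balaban1985RegularSpaces, Prop. 3 p.87] -/
theorem prop3Printed_hp2per_of_zd {J : Type} (ι : J → ZdIdx d L) (p : J → ℕ) {Lr C₂ : ℝ} {inp : B8.B9Inputs} {B₀β : ℝ}
    (h : B8.Prop3Printed d Lr C₂ inp B₀β (fun j : J => (zdGF3HP₂ 𝔸 L β len (ι j)).toGFData2)) :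
    B8.Prop3Printed d Lr C₂ inp B₀β (fun j : J => (zdGF3HP₂Per 𝔸 L β len (ι j) (p j)).toGFData2) := by
  obtain ⟨c, hc, hb⟩ := h
  exact ⟨c, hc, prop3Body_hp2per_of_zd ι p hb⟩

end Prop3

end Literature.MathematicalPhysics.QuantumFieldTheory.Balaban1983to89.B8LeafModelZdHP2Per
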